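import Literature.Computability.FineGrained.CliqueETHDedupProgram
import Literature.Computability.FineGrained.CliqueETHTMBridge
import Literature.Computability.Cryptography.WordRAMProofs
import HarnessLib

/-!
# ETH-hardness of `k`-Clique: `k`-SAT deciders are robust under repeated clauses and larger words

The word-RAM half of the machine-model bridge `ethWordRAM_of_eth` of `…FineGrained.CliqueETH`
(Wave0's Turing-machine `ETH` implies word-RAM ETH; V. Vassilevska Williams, ICM 2018, §2: the
hypotheses of fine-grained complexity are stated on the word RAM and are robust under the details
of the machine model; Cook–Reckhow, JCSS 7 (1973), §2). The Turing-machine half is in the tree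
(`sparseKSATInExpTime_of_liberalSparseKSATInRAMTime_holds`, `CliqueETHMachineModel.lean`, and
`kSATInExpTime_of_sparseKSATInExpTime sparsification_holds`, `CliqueETHTMBridge.lean`); what it
consumes is a word-RAM decider in the *liberal* form `LiberalSparseKSATInRAMTime k c δ` (clause
lists with repetitions, every word size from `k'' · (n + inputWidth x)` on), whereas word-RAM ETH
speaks about `KSATInRAMTime k δ` (the accepted `kSATProblem k`: no repeated clause, word size
exactly `k' · (n + inputWidth x)`). The verified deduplication wrapper `DedupWrap.wrapper` of
`CliqueETHDedupProgram.lean` (relocate, deduplicate the clause list, emulate the decider at its own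
word size on the code of `List.dedup φ`; `DedupWrap.Params.wrapper_outputsWithin`) closes that gap
once its word size and running time are controlled, which is done here:

* `ETHBridge.fits` — at every word size `W ≥ (k' + cM + 12) · (n + inputWidth x)` (`cM` the
  largest constant of the decider), the wrapper's requirement `DedupWrap.Params.Fits W` holds
  (`fits_mono`);
* `ETHBridge.Tpre_le` — for clause lists of width `≤ k` with `m ≤ c · n` clauses the build and
  read-out of the wrapper cost at most `B(k, c) · (n + 1)³` steps for an explicit cubic `B`;
* `ETHBridge.kM_pos` — a word-size constant `k' = 0` in `KSATInRAMTime` is contradictory (at word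
  size `0` every input reads as zeros, so `[]` and `[[]]` get the same answer; `init_zero_eq`,
  `outputsWithin_unique_holds`);
* **`liberalSparseKSATInRAMTime_of_kSATInRAMTime`** — `0 < δ → KSATInRAMTime k δ →
  LiberalSparseKSATInRAMTime k c δ` for every density `c` (the cubic overhead is absorbed by
  `2^{δ n}`, `exists_pow_le_two_rpow`).

## References

* V. Vassilevska Williams, *On some fine-grained questions in algorithms and complexity*,
  Proc. ICM 2018, §2 (the word RAM; robustness of the hypotheses under the machine model).
* S. A. Cook, R. A. Reckhow, *Time bounded random access machines*, JCSS 7 (1973) 354–375, §2.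
* R. Impagliazzo, R. Paturi, *On the complexity of k-SAT*, JCSS 62 (2001), §1 (`k`-SAT on clause
  lists; ETH).
-/

namespace Literature.Computability.FineGrained

open Cryptography Cryptography.WordRAM Complexity Cryptography.WordRAM.SProg

namespace ETHBridge

/-! ### The word size -/

/-- `Fits` of the wrapper is monotone in the word size. [folklore] -/
theorem fits_mono {g : DedupWrap.Params} {W W' : ℕ} (h : g.Fits W) (hW : W ≤ W') : g.Fits W' :=
  ⟨h.top.trans (Nat.pow_le_pow_right Nat.two_pos hW), lt_of_lt_of_le h.ws_lt hW, h.width.trans hW,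
    h.lx3.trans (Nat.pow_le_pow_right Nat.two_pos hW)⟩

/-- **The word size fits**: at `W = (kM + cM + 12) · (n + inputWidth x)` the wrapper's
requirements `Fits` hold — the stamps end below `2 ^ W` (`2 Lx + 2 · 2^{ws} + 2 cM + 103 ≤ 2 ^ W` with
`Lx < 2^{inputWidth x}` and `ws ≤ kM · (n + inputWidth x)`), the emulated word size is below `W`,
the input width is at most `W`, and `3 Lx + 103 ≤ 2 ^ W`. [folklore] -/
theorem fits (g : DedupWrap.Params) : g.Fits ((g.kM + g.cM + 12) * (g.n + inputWidth g.x)) := by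
  -- notation
  set iw := inputWidth g.x with hiw
  set E := g.n + iw with hE
  have hiw1 : 1 ≤ iw := inputWidth_pos _
  have hE1 : 1 ≤ E := by omega
  have hLx : g.Lx < 2 ^ iw := length_lt_two_pow_inputWidth _
  have h2E : 2 ^ iw ≤ 2 ^ E := Nat.pow_le_pow_right Nat.two_pos (by omega)
  have hσ : g.σ ≤ iw := by rw [g.sigma_eq]; exact DedupWrap.inputWidth_dedup_le g.φ
  have hws : g.ws ≤ g.kM * E := by
    unfold DedupWrap.Params.ws; exact Nat.mul_le_mul_left _ (Nat.add_le_add_left hσ _)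
  have hPw : g.Pw ≤ 2 ^ (g.kM * E) := Nat.pow_le_pow_right Nat.two_pos hws
  have hV : g.V ≤ g.Pw + g.cM := max_le (by omega) (by omega)
  -- the word size
  set W := (g.kM + g.cM + 12) * E with hWdef
  have hWeq : W = g.kM * E + g.cM * E + 12 * E := by rw [hWdef]; ring
  have hcME : g.cM ≤ g.cM * E := Nat.le_mul_of_pos_right _ hE1
  have hW1 : g.kM * E + E + g.cM + 9 ≤ W := by omega
  have hW2 : E + 8 ≤ W := by have := Nat.zero_le (g.kM * E); omega
  -- top
  set P := 2 ^ (g.kM * E + E + g.cM + 7) with hP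
  have hPE : ∀ t, t ≤ g.kM * E + E + g.cM + 7 → 2 ^ t ≤ P := fun t ht =>
    Nat.pow_le_pow_right Nat.two_pos ht
  have t1 : 2 * g.Lx ≤ P := by
    calc 2 * g.Lx ≤ 2 * 2 ^ E := by omega
      _ = 2 ^ (E + 1) := by rw [Nat.pow_succ]; ring
      _ ≤ P := hPE _ (by omega)
  have t2 : 2 * g.Pw ≤ P := by
    calc 2 * g.Pw ≤ 2 * 2 ^ (g.kM * E) := by omega
      _ = 2 ^ (g.kM * E + 1) := by rw [Nat.pow_succ]; ring
      _ ≤ P := hPE _ (by omega)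
  have t3 : 2 * g.cM ≤ P := by
    calc 2 * g.cM ≤ 2 * 2 ^ g.cM := by have := @Nat.lt_two_pow_self g.cM; omega
      _ = 2 ^ (g.cM + 1) := by rw [Nat.pow_succ]; ring
      _ ≤ P := hPE _ (by omega)
  have t4 : 103 ≤ P := by
    calc (103 : ℕ) ≤ 2 ^ 7 := by norm_num
      _ ≤ P := hPE _ (by omega)
  have htop : g.Sv + g.V + 1 ≤ 2 ^ W := by
    have h4P : 4 * P = 2 ^ (g.kM * E + E + g.cM + 9) := by
      rw [hP, show g.kM * E + E + g.cM + 9 = g.kM * E + E + g.cM + 7 + 2 by omega, Nat.pow_add]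
      norm_num; ring
    have : g.Sv + g.V + 1 = 2 * g.Lx + 2 * g.V + 103 := by
      unfold DedupWrap.Params.Sv DedupWrap.Params.Bv DedupWrap.Params.X; ring
    rw [this]
    calc 2 * g.Lx + 2 * g.V + 103 ≤ 2 * g.Lx + 2 * g.Pw + 2 * g.cM + 103 := by omega
      _ ≤ 4 * P := by omega
      _ = 2 ^ (g.kM * E + E + g.cM + 9) := h4P
      _ ≤ 2 ^ W := Nat.pow_le_pow_right Nat.two_pos hW1
  -- lx3
  have hlx3 : 3 * g.Lx + 103 ≤ 2 ^ W := by
    calc 3 * g.Lx + 103 ≤ 4 * 2 ^ E + 128 * 2 ^ E := by have := Nat.one_le_two_pow (n := E); omega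
      _ = 2 ^ (E + 2) + 2 ^ (E + 7) := by rw [Nat.pow_add, Nat.pow_add]; norm_num; ring
      _ ≤ 2 ^ (E + 7) + 2 ^ (E + 7) := by
          have := Nat.pow_le_pow_right Nat.two_pos (show E + 2 ≤ E + 7 by omega); omega
      _ = 2 ^ (E + 8) := by rw [Nat.pow_succ]; ring
      _ ≤ 2 ^ W := Nat.pow_le_pow_right Nat.two_pos hW2
  refine ⟨htop, ?_, ?_, hlx3⟩
  · calc g.ws ≤ g.kM * E := hws
      _ < W := by omega
  · show iw ≤ W; omega

/-! ### The time of the build in terms of `n` -/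

/-- The size of a CNF of width `≤ k` is at most `k m`. [folklore] -/
theorem size_le_of_isWidthLE {k : ℕ} {φ : CNF ℕ} (hw : φ.IsWidthLE k) : CNF.size φ ≤ k * φ.length := by
  unfold CNF.size
  induction φ with
  | nil => simp
  | cons c φ ih =>
    simp only [List.map_cons, List.sum_cons, List.length_cons]
    have h1 := hw c (by simp)
    have h2 := ih (fun d hd => hw d (by simp [hd]))
    nlinarith

/-- `Lx ≤ 2 + m (k + 1)` for width `≤ k`. [folklore] -/
theorem Lx_le (g : DedupWrap.Params) {k : ℕ} (hw : g.φ.IsWidthLE k) : g.Lx ≤ 2 + g.m * (k + 1) := by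
  have := size_le_of_isWidthLE hw
  unfold DedupWrap.Params.Lx DedupWrap.Params.x DedupWrap.Params.m at *
  rw [length_encodeCNFWords_eq, CNF.numClauses]; nlinarith

/-- `σ ≤ Lx + 2 n`: the input width of the emulated input is at most its defining quantity
`max |y| (2 n - 1)`. [folklore] -/
theorem sigma_le (g : DedupWrap.Params) : g.σ ≤ g.Lx + 2 * g.n := by
  have h1 : g.σ ≤ g.wv := CliqueRed.size_le_self _
  have h2 : g.wv ≤ g.Lx + 2 * g.n := max_le (g.Ly_le_Lx.trans (Nat.le_add_right _ _)) (by omega)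
  omega

/-- **The build plus read-out of the wrapper is cubic in `n`** for clause lists of width `≤ k`
with `m ≤ c n` clauses: `Tpre + 4 ≤ B · (n + 1)³` with the explicit coefficient
`B = c² (12 D + 14) + c (10 D + 20) + 11 D + 144`, `D = c (k + 1) + 2` (so that `Lx ≤ D (n + 1)`).
[folklore] -/
theorem Tpre_le (g : DedupWrap.Params) {k c : ℕ} (hw : g.φ.IsWidthLE k) (hc : g.m ≤ c * g.n) :
    g.Tpre + 4 ≤ (c * c * (12 * (c * (k + 1) + 2) + 14) + c * (10 * (c * (k + 1) + 2) + 20) + 11 * (c * (k + 1) + 2) + 144) *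
      (g.n + 1) ^ 3 := by
  set n := g.n with hn
  set m := g.m with hm
  set D := c * (k + 1) + 2 with hD
  have hLx : g.Lx ≤ D * (n + 1) := by
    have h1 := Lx_le g hw
    have h2 : m * (k + 1) ≤ c * n * (k + 1) := Nat.mul_le_mul_right _ hc
    rw [hD]; nlinarith
  have hσ := sigma_le g
  have hK : g.Kouter = m * (g.Lx * 12 + 14) + g.Lx * 10 + 18 := rfl
  have hT : g.Tpre = 7 * g.Lx + 7 + (m * (g.Kouter + 2) + 1) + 7 + (g.σ * 4 + 10) + 11 + 96 := rfl
  -- the cube and its faces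
  set N := n + 1 with hN
  have hN1 : 1 ≤ N := by omega
  have hnN : n ≤ N := by omega
  have hmN : m ≤ c * N := hc.trans (Nat.mul_le_mul_left _ hnN)
  have hN2 : N ≤ N ^ 2 := by nlinarith
  have hN3 : N ^ 2 ≤ N ^ 3 := by
    calc N ^ 2 = N ^ 2 * 1 := (Nat.mul_one _).symm
      _ ≤ N ^ 2 * N := Nat.mul_le_mul_left _ hN1
      _ = N ^ 3 := by ring
  have hN13 : N ≤ N ^ 3 := hN2.trans hN3
  -- term by term
  have e1 : m * (m * (g.Lx * 12 + 14)) ≤ c * c * (12 * D + 14) * N ^ 3 := by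
    have f1 : g.Lx * 12 + 14 ≤ (12 * D + 14) * N := by nlinarith
    calc m * (m * (g.Lx * 12 + 14)) ≤ (c * N) * ((c * N) * ((12 * D + 14) * N)) := by
          gcongr
      _ = c * c * (12 * D + 14) * N ^ 3 := by ring
  have e2 : m * (g.Lx * 10 + 18 + 2) ≤ c * (10 * D + 20) * N ^ 3 := by
    have f1 : g.Lx * 10 + 18 + 2 ≤ (10 * D + 20) * N := by nlinarith
    calc m * (g.Lx * 10 + 18 + 2) ≤ (c * N) * ((10 * D + 20) * N) := by gcongr
      _ = c * (10 * D + 20) * N ^ 2 := by ring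
      _ ≤ c * (10 * D + 20) * N ^ 3 := Nat.mul_le_mul_left _ hN3
  have e3 : 7 * g.Lx ≤ 7 * D * N ^ 3 := by
    calc 7 * g.Lx ≤ 7 * (D * N) := by omega
      _ = 7 * D * N := by ring
      _ ≤ 7 * D * N ^ 3 := Nat.mul_le_mul_left _ hN13
  have e4 : g.σ * 4 ≤ (4 * D + 8) * N ^ 3 := by
    calc g.σ * 4 ≤ (D * N + 2 * n) * 4 := by omega
      _ ≤ (D * N + 2 * N) * 4 := by gcongr
      _ = (4 * D + 8) * N := by ring
      _ ≤ (4 * D + 8) * N ^ 3 := Nat.mul_le_mul_left _ hN13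
  have e5 : 136 ≤ 136 * N ^ 3 := Nat.le_mul_of_pos_right _ (by positivity)
  have hsum : g.Tpre + 4 = 7 * g.Lx + (m * (m * (g.Lx * 12 + 14)) + m * (g.Lx * 10 + 18 + 2)) +
      g.σ * 4 + 136 := by
    rw [hT, hK]; ring
  rw [hsum]
  calc 7 * g.Lx + (m * (m * (g.Lx * 12 + 14)) + m * (g.Lx * 10 + 18 + 2)) + g.σ * 4 + 136
      ≤ 7 * D * N ^ 3 + (c * c * (12 * D + 14) * N ^ 3 + c * (10 * D + 20) * N ^ 3) +
        (4 * D + 8) * N ^ 3 + 136 * N ^ 3 :=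
        Nat.add_le_add (Nat.add_le_add (Nat.add_le_add e3 (Nat.add_le_add e1 e2)) e4) e5
    _ = (c * c * (12 * (c * (k + 1) + 2) + 14) + c * (10 * (c * (k + 1) + 2) + 20) + 11 * (c * (k + 1) + 2) + 144) * N ^ 3 := by
        rw [hD]; ring

/-! ### Word size `0` is contradictory -/

/-- At word size `0` every initial configuration is the same: all cells are reduced modulo `1`.
[folklore] -/
theorem init_zero_eq (x y : List ℕ) : init 0 x = init 0 y := by
  have h : ∀ z : List ℕ, (init 0 z).mem = fun _ => 0 := fun z => by
    funext a
    rcases Nat.eq_zero_or_pos a with rfl | ha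
    · rw [init_mem_zero]; exact Nat.mod_one _
    · obtain ⟨i, rfl⟩ := Nat.exists_eq_add_of_le' ha
      by_cases hi : i < z.length
      · rw [init_mem_succ _ _ _ hi]; exact Nat.mod_one _
      · exact init_mem_of_length_lt _ _ _ (by omega)
  have key : ∀ z : List ℕ, init 0 z = ⟨some 0, fun _ => 0, 0, []⟩ := fun z => by
    have hz := h z
    cases hc : init 0 z with
    | mk pc mem cp qs =>
      have hpc : (init 0 z).pc = pc := by rw [hc]
      have hcp : (init 0 z).coinPos = cp := by rw [hc]
      have hqs : (init 0 z).queries = qs := by rw [hc]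
      rw [hc] at hz
      rw [init_pc] at hpc; rw [init_coinPos] at hcp; rw [init_queries] at hqs
      subst hpc hcp hqs
      simp only at hz
      rw [hz]
  rw [key x, key y]

/-- At word size `0`, the output of a run does not depend on the input. [folklore] -/
theorem outputsWithin_zero_of {M : Program} {O : List ℕ → List ℕ} {ρ : ℕ → ℕ} {x out : List ℕ}
    {t : ℕ} (h : OutputsWithin M 0 O ρ x out t) (y : List ℕ) : OutputsWithin M 0 O ρ y out t := by
  obtain ⟨c, ⟨e⟩, hs, ho⟩ := h
  exact ⟨c, ⟨init_zero_eq x y ▸ e⟩, hs, ho⟩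

/-- **A word-size constant `0` is contradictory for a `k`-SAT decider**: `[]` (satisfiable) and
`[[]]` (unsatisfiable) are both instances of `kSATProblem k`, and at word size `0` a program
answers both in the same way (`outputsWithin_unique_holds`). [folklore] -/
theorem kM_pos {k : ℕ} {M : Program} {T : (kSATProblem k).Inst → ℕ}
    (hM : ∀ φ : (kSATProblem k).Inst, ∃ out ∈ (kSATProblem k).Good φ,
      OutputsWithin M (0 * ((kSATProblem k).size φ + (kSATProblem k).width φ)) noOracle zeroCoins
        ((kSATProblem k).encode φ) out (T φ)) : False := by
  let φ₁ : (kSATProblem k).Inst := ⟨[], fun c hc => by simp at hc, List.nodup_nil⟩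
  let φ₂ : (kSATProblem k).Inst := ⟨[[]], fun c hc => by simp at hc; simp [hc], by simp⟩
  obtain ⟨out₁, hout₁, h₁⟩ := hM φ₁
  obtain ⟨out₂, hout₂, h₂⟩ := hM φ₂
  have e₁ : out₁ = [1] := by
    have : out₁ ∈ CNFSAT.Good ([] : CNF ℕ) := hout₁
    rw [CNFSAT_good_iff, if_pos CNF.satisfiable_nil] at this; exact this
  have e₂ : out₂ = [0] := by
    have : out₂ ∈ CNFSAT.Good ([[]] : CNF ℕ) := hout₂
    rw [CNFSAT_good_iff, if_neg (CNF.not_satisfiable_of_nil_mem (by simp))] at this; exact this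
  rw [zero_mul] at h₁ h₂
  have := outputsWithin_unique_holds (outputsWithin_zero_of h₁ ((kSATProblem k).encode φ₂)) h₂
  rw [e₁, e₂] at this
  simp at this

end ETHBridge

/-! ### The named consequence: the liberal form of a `k`-SAT decider -/

open ETHBridge in
open scoped Classical in
/-- **`k`-SAT deciders are robust under repeated clauses and larger words.** A deterministic
word-RAM decider for the accepted `kSATProblem k` running within `⌊C · 2^{δ n} + C⌋₊` steps at word
size `k' · (n + inputWidth x)` (`KSATInRAMTime k δ`) yields, for every density `c`, a decider of
the clause lists of width `≤ k` with at most `c · n` clauses, repetitions allowed, at every word size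
`W ≥ (k' + cM + 12) · (n + inputWidth x)`, within `⌊C' · 2^{δ n} + C'⌋₊` steps (`LiberalSparseKSATInRAMTime k c δ`):
the wrapper `DedupWrap.wrapper M k'` of `CliqueETHDedupProgram.lean` deduplicates the clause list
(cubic time, absorbed by `2^{δ n}` for `δ > 0`, `Tpre_le`) and emulates `M` at its own word size on
the code of the deduplicated list, whose `numVars`, input width and satisfiability are those of the
input (`DedupWrap.Params.wrapper_outputsWithin`, `DedupWrap.Params.ws_eq`, `fits`); `k' = 0` is
contradictory (`kM_pos`). This is the word-RAM half of the robustness of ETH under the machine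
model (V. Vassilevska Williams, ICM 2018, §2). [cite: VassilevskaWilliamsICM2018, §2] -/
theorem liberalSparseKSATInRAMTime_of_kSATInRAMTime {k : ℕ} {δ : ℝ} (hδ : 0 < δ)
    (h : KSATInRAMTime k δ) (c : ℕ) : LiberalSparseKSATInRAMTime k c δ := by
  obtain ⟨M, kM, C, hdet, hof, hM⟩ := h
  rcases Nat.eq_zero_or_pos kM with rfl | hkM
  · exact (kM_pos hM).elim
  obtain ⟨C₃, hC₃0, hC₃⟩ := exists_pow_le_two_rpow 3 hδ
  set C' : ℝ := max C 0 with hC'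
  have hC'0 : 0 ≤ C' := le_max_right _ _
  set B : ℕ := (c * c * (12 * (c * (k + 1) + 2) + 14) + c * (10 * (c * (k + 1) + 2) + 20) + 11 * (c * (k + 1) + 2) + 144) with hB
  set A : ℝ := (B : ℝ) * C₃ + 76 * C' with hA
  have hA0 : 0 ≤ A := by positivity
  refine ⟨DedupWrap.wrapper M kM, kM + M.maxConst + 12, A, DedupWrap.wrapper_isDeterministic M kM,
    DedupWrap.wrapper_isOracleFree M kM, fun φ hw hsparse W hW => ?_⟩
  -- the ghost parameters of this run
  set g : DedupWrap.Params := ⟨φ, kM, M.maxConst⟩ with hgdef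
  have hx : encodeCNFWords φ = g.x := rfl
  have hn : CNF.numVars φ = g.n := rfl
  rw [hx, hn] at hW ⊢
  have hF : g.Fits W := fits_mono (fits g) hW
  have hcg : g.m ≤ c * g.n := hsparse
  have hwg : g.φ.IsWidthLE k := hw
  -- the decider on the deduplicated instance
  let φd : (kSATProblem k).Inst := ⟨φ.dedup, DedupWrap.isWidthLE_dedup hw, List.nodup_dedup φ⟩
  obtain ⟨out, hout, hrun⟩ := hM φd
  have hsz : (kSATProblem k).size φd = g.n := DedupWrap.numVars_dedup φ
  have hws : kM * ((kSATProblem k).size φd + (kSATProblem k).width φd) = g.ws := g.ws_eq.symm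
  have henc : (kSATProblem k).encode φd = g.y := rfl
  have hgood : out = [if φ.Satisfiable then 1 else 0] := by
    have : out ∈ CNFSAT.Good φ.dedup := hout
    rw [CNFSAT_good_iff] at this
    rw [this]
    by_cases hs : φ.Satisfiable
    · rw [if_pos hs, if_pos ((DedupWrap.satisfiable_dedup_iff φ).2 hs)]
    · rw [if_neg hs, if_neg (mt (DedupWrap.satisfiable_dedup_iff φ).1 hs)]
  rw [hws, henc, hgood, hsz] at hrun
  have hred := g.wrapper_outputsWithin hF hkM hdet hof rfl hrun
  refine ⟨_, (CNFSAT_good_iff φ _).2 rfl, hred.mono ?_⟩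
  -- the time bound
  set n := g.n
  have hT := Tpre_le g hwg hcg
  apply Nat.le_floor
  have hpos : (0 : ℝ) < (2 : ℝ) ^ (δ * n) := by positivity
  have hone : (1 : ℝ) ≤ (2 : ℝ) ^ (δ * n) := Real.one_le_rpow (by norm_num) (by positivity)
  have hfl : ((⌊C * (2 : ℝ) ^ (δ * (n : ℝ)) + C⌋₊ : ℕ) : ℝ) ≤ C' * (2 : ℝ) ^ (δ * n) + C' := by
    have h1 : C * (2 : ℝ) ^ (δ * (n : ℝ)) + C ≤ C' * (2 : ℝ) ^ (δ * n) + C' :=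
      add_le_add (mul_le_mul_of_nonneg_right (le_max_left _ _) hpos.le) (le_max_left _ _)
    exact (Nat.cast_le.2 (Nat.floor_le_floor h1)).trans (Nat.floor_le (by positivity))
  have hTr : ((g.Tpre + 4 : ℕ) : ℝ) ≤ (B : ℝ) * C₃ * (2 : ℝ) ^ (δ * n) := by
    have h1 : ((g.Tpre + 4 : ℕ) : ℝ) ≤ ((B * (n + 1) ^ 3 : ℕ) : ℝ) := by exact_mod_cast hT
    have h2 : ((B * (n + 1) ^ 3 : ℕ) : ℝ) = (B : ℝ) * ((n : ℝ) + 1) ^ 3 := by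
      push_cast; ring
    rw [h2] at h1
    calc ((g.Tpre + 4 : ℕ) : ℝ) ≤ (B : ℝ) * ((n : ℝ) + 1) ^ 3 := h1
      _ ≤ (B : ℝ) * (C₃ * (2 : ℝ) ^ (δ * n)) :=
          mul_le_mul_of_nonneg_left (hC₃ n) (Nat.cast_nonneg _)
      _ = _ := by ring
  unfold DedupWrap.Params.Ttotal
  push_cast
  have hcs : (cstep : ℝ) = 38 := by norm_num [cstep]
  rw [hcs]
  have e : ((g.Tpre : ℕ) : ℝ) + 38 * ((⌊C * (2 : ℝ) ^ (δ * (n : ℝ)) + C⌋₊ : ℕ) : ℝ) + 4 =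
      ((g.Tpre + 4 : ℕ) : ℝ) + 38 * ((⌊C * (2 : ℝ) ^ (δ * (n : ℝ)) + C⌋₊ : ℕ) : ℝ) := by
    push_cast; ring
  rw [e]
  calc ((g.Tpre + 4 : ℕ) : ℝ) + 38 * ((⌊C * (2 : ℝ) ^ (δ * (n : ℝ)) + C⌋₊ : ℕ) : ℝ)
      ≤ (B : ℝ) * C₃ * (2 : ℝ) ^ (δ * n) + 38 * (C' * (2 : ℝ) ^ (δ * n) + C') := by
        gcongr
    _ ≤ (B : ℝ) * C₃ * (2 : ℝ) ^ (δ * n) +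
          38 * (C' * (2 : ℝ) ^ (δ * n) + C' * (2 : ℝ) ^ (δ * n)) := by
        have h38 : C' ≤ C' * (2 : ℝ) ^ (δ * n) := le_mul_of_one_le_right hC'0 hone
        linarith
    _ = A * (2 : ℝ) ^ (δ * n) := by rw [hA]; ring
    _ ≤ A * (2 : ℝ) ^ (δ * n) + A := by linarith

end Literature.Computability.FineGrained
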